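import Summits.QuantumFields.YangMills.Theorems.BalabanUVNodesN15PerCubeGreenTwoGridSecondLettersOfReg335D2
import HarnessLib

/-!
# N15 = NE2, road (c) — PROGRAMME (PC), (PC-E) THE DIVERGENCE FIT o_B: THE PRINT-ANCHORED DATUM — (3.35) OF [B9] PLUS THE LIPSCHITZ (β = 1) HÖLDER CLAUSE OF [Balaban1985Variational]
# THEOREM 1 (9) «‖A‖_{1,β} < B₄(β₀)Mε₁(Lʲη)^{−2−β} for 0 ≤ β ≤ β₀ = 1» WITH ITS OWN CONSTANT — `Reg335LipCube T U η □ ξ C C₁` (n15-c∕356's `Reg335D2Cube` is the case `C₁ = C`),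
# the third group letter with `C₁`, the unitary gauge with three letters (dag-n15-c g33, n15-c∕360)

Cell `pub-ymgap`, seat `pub-ymgap-dag-n15-c` (generation g33; R134 (a) seat, strategy s1 «first missing estimate»; HUMAN RULING D-0062; chair R424 venue).
`bears_on: R4∕N15 · K3⁸ SpineGivenEndpointR13SepCoPHV (stmt-QuantumFields-27366)`; filed `--supports stmt-QuantumFields-27366 --as helper` — COUNT-NEUTRAL.
ONE `def` (`Reg335LipCube`, review lane) + theorems; 0 `sorry`.  Imports BY NAME n15-c∕356 (`Reg335D2Cube`, `norm_exp_fourPoint_le`, `covD_one_covD_one_apply`; through it dag-n15-w2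
`bondLetters_of_gauge335`, `uN_opLetters_of_gauge335`, `uN_val_gaugeTr_eq`, `val_fluct`, `covD_one_apply'`, `norm_I_eta_smul`, r06 `Reg335Cube`).  Nothing in the tree is modified, no landed
name re-declared.

WHY (located while writing n15-c∕356–359; READ: [Balaban1985Variational] Thm 1 p. 279 via lit-balaban's `B11Holder9` module docstring, [Balaban1985RegularSpaces] pp. 81–83, 101).
n15-c∕356 typed the third letter as «|∇^η∇^ηA| < Cξ⁻³» with THE SAME constant `C` as (3.35) and called it MODEL.  The print is closer than that: the per-cube regularity that the series
actually carries for background fields is [Balaban1985Variational] Theorem 1 (9)–(10) p. 279: «for an arbitrary cube □ … there exists a gauge transformation u … U^{u^{−1}} = e^{iηA},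
|A| < B₃Mε₁(Lʲη)^{−1}, |∇^ηA| < B₃Mε₁(Lʲη)^{−2}, ‖A‖_{1,β} < B₄(β₀)Mε₁(Lʲη)^{−2−β} for 0 ≤ β ≤ β₀ = 1, (9) |∂^{η*}∂^ηA|, |Δ^ηA| < B₃Mε₁(Lʲη)^{−3}. (10)» — the Hölder seminorm
`‖A‖_{1,β} = ‖∇^ηA‖_β` ([Balaban1985BackgroundPropagators] (3.40) p. 397).  AT THE PRINTED ENDPOINT `β = β₀ = 1` the clause `‖A‖_{1,1} < B₄(1)Mε₁(Lʲη)^{−3}` IS a bound on ALL second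
differences: `|∇^η_κ′∇^η_κA_ν| ≤ B₄(1)Mε₁(Lʲη)^{−3}` — exactly n15-c∕356's third clause, with its OWN constant `C₁ = B₄Mε₁` next to (3.35)'s `C = B₃Mε₁`.  lit-balaban's reading
(`B11Holder9`, cell GAPS C-B8-18) records that the series' PROOFS deliver `β ≤ β₀ < 1` only ([Balaban1985RegularSpaces] Thm 2 (1.36)); for `β < 1` the Hölder clause still gives the
per-step second difference `|∇_κA_ν(x + ηe_κ′) − ∇_κA_ν(x)| ≤ B₄(β)Mε₁(Lʲη)^{−2−β}η^β`, i.e. THIS file's datum with the `η`-dependent constant `C₁ := B₄(β)Mε₁·((Lʲη)∕η)^{1−β}` — which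
is why `C₁` must be INDEPENDENT of `C` (the smallness condition of the chain is on `C` alone; `C₁` only enters `o_B`, linearly, and `η·C₁ = O(η^β)` still vanishes).
* §1 ★ `Reg335LipCube T U η □ ξ C C₁` (r06's (3.35) datum + `‖∇^η_κ′∇^η_κA_ν‖ < C₁ξ⁻³` on □), `Reg335LipCube.reg335Cube`, `Reg335D2Cube.lipCube` (`C₁ := C`),
  ★★ `secondLetter_of_gauge335Lip` (`‖U^u_ν(z+e_κ+e_κ′) − U^u_ν(z+e_κ′) − U^u_ν(z+e_κ) + U^u_ν(z)‖ ≤ η³((C₁∕ξ³) + η(C∕ξ²)²)e^{5ηC∕ξ}`), `exists_gauge_threeLetters_of_reg335LipCube`.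
* §2 (`𝔸 = M_n(ℂ)`) ★★★ `uN_exists_gauge_threeLetters_of_reg335LipCube` (unitary gauge everywhere; pointwise, all-direction step, and second-difference letters), §3 `reg335LipCube_one`.
* §4 (v1.1, APPENDED; §1–§3 byte-identical to v1 p811254) ★ `reg335LipCube_of_holderStep` — the per-step reading of the Hölder clause at exponent `β` («‖A‖_{1,β} < C_β(Lʲη)^{−2−β}»:
  `‖∇^η_κA_ν(z+e_κ′) − ∇^η_κA_ν(z)‖ < C_βξ^{−(2+β)}η^β`) makes `(u, A)` a `Reg335LipCube` witness with `C₁ := C_β(ξ∕η)^{1−β}` — kernel-checked form of the sentence «`β < 1` enters with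
  an `η`-dependent `C₁`» above.

HONEST FRAMING ∕ LIMITS.  A regularity DATUM (hypothesis), typed: (3.35) as r06 typed it + the β = 1 reading of the printed Hölder clause (9) with a free constant; the PRODUCTION of
such data from small plaquette fields ([Balaban1985RegularSpaces] Thm 2, [Balaban1985Variational] Thm 1 — node N04's business) is NOT claimed, and the cell's caveat on the endpoint
`β₀ = 1` (proved: `β < 1`) is recorded above, with the `β < 1` use of this datum (η-dependent `C₁`).  Exponential bookkeeping only; nothing of [B9]∕[B11] asserted.  NE2⁺ NOT PRINTED ∕
NOT proved; N15 of record untouched; K3⁸ OPEN; counts of record UNMOVED (typed 28∕28 · discharged 8∕27); one finite 𝕋⁴ at fixed ε per index — NOT infinite volume, NOT OS on ℝ⁴, NOT a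
mass gap, NOT Clay.  Restate-immune (no Theses import).
-/

set_option autoImplicit false

noncomputable section

open scoped BigOperators Matrix
open scoped Nat

namespace Summit.QuantumFields.YangMills.BalabanUVNodes.N15.CurvedSpecies

/-! ## §1 The datum (3.35) + Lipschitz clause of (9) with its own constant, and the third group letter -/

section Generic

open NormedSpace
open Literature.MathematicalPhysics.QuantumFieldTheory.Balaban1983to89
open Literature.MathematicalPhysics.QuantumFieldTheory.Balaban1983to89.B9Eq39Adjoint (covD fluct)
open Literature.MathematicalPhysics.QuantumFieldTheory.Balaban1983to89.B9Eq3117Current (gaugeTr)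
open Literature.MathematicalPhysics.QuantumFieldTheory.Balaban1983to89.B9Eq335RegularityClasses (Reg335Cube norm_le_eta_mul_of_norm_inv_smul_lt)

variable {𝔸 : Type*} [NormedRing 𝔸] [NormedAlgebra ℂ 𝔸] [CompleteSpace 𝔸] [NormOneClass 𝔸] {S ι : Type*}
  (T : ι → Equiv.Perm S) (U : ι → S → 𝔸ˣ)

omit [NormOneClass 𝔸] in
/-- ★ **THE DATUM (3.35) + THE LIPSCHITZ CLAUSE OF (9), WITH ITS OWN CONSTANT** — r06's `Reg335Cube T U η □ ξ C` («there exists a gauge transformation u on □ such that U^u = e^{iηA} …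
|A| < Cξ⁻¹, |∇^ηA| < Cξ⁻² on □», flat `∇^η = η⁻¹D¹`) TOGETHER WITH the flat second derivative `‖∇^η_κ′∇^η_κA_ν‖ < C₁ξ⁻³` on □ for ALL `κ, κ′, ν` — the `β = β₀ = 1` endpoint of the printed
Hölder clause «‖A‖_{1,β} < B₄(β₀)Mε₁(Lʲη)^{−2−β} for 0 ≤ β ≤ β₀ = 1» with `C₁` in place of `B₄Mε₁` (n15-c∕356's `Reg335D2Cube` is the case `C₁ = C`).
[cite: Balaban1985BackgroundPropagators, (3.35) p.396, (3.40) p.397; Balaban1985Variational, Thm 1 (9) p.279] -/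
def Reg335LipCube (η : ℝ) (cube : Set S) (ξ C C₁ : ℝ) : Prop :=
  ∃ (u : S → 𝔸ˣ) (A : ι → S → 𝔸),
    (∀ z ∈ cube, ‖(u z : 𝔸)‖ ≤ 1 ∧ ‖(((u z)⁻¹ : 𝔸ˣ) : 𝔸)‖ ≤ 1) ∧
    (∀ κ, ∀ z ∈ cube, gaugeTr T u U κ z = fluct η A κ z) ∧
    (∀ κ, ∀ z ∈ cube, ‖A κ z‖ < C * ξ⁻¹) ∧
    (∀ κ ν, ∀ z ∈ cube, ‖((η : ℂ)⁻¹) • covD T (fun _ _ => (1 : 𝔸ˣ)) κ (A ν) z‖ < C * (ξ ^ 2)⁻¹) ∧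
    (∀ κ κ' ν, ∀ z ∈ cube, ‖((η : ℂ)⁻¹) • covD T (fun _ _ => (1 : 𝔸ˣ)) κ' (fun w => ((η : ℂ)⁻¹) • covD T (fun _ _ => (1 : 𝔸ˣ)) κ (A ν) w) z‖ < C₁ * (ξ ^ 3)⁻¹)

omit [NormOneClass 𝔸] in
/-- The datum contains r06's (3.35) datum on the cube. [cite: Balaban1985BackgroundPropagators, (3.35) p.396] -/
theorem Reg335LipCube.reg335Cube {η : ℝ} {cube : Set S} {ξ C C₁ : ℝ} (h : Reg335LipCube T U η cube ξ C C₁) : Reg335Cube T U η cube ξ C := by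
  obtain ⟨u, A, hu, hg, hA, hD, -⟩ := h
  exact ⟨u, A, hu, hg, hA, hD⟩

omit [NormOneClass 𝔸] in
/-- n15-c∕356's MODEL datum is the case `C₁ = C`. [cite: Balaban1985BackgroundPropagators, (3.35)–(3.36) p.396 (shape)] -/
theorem Reg335D2Cube.lipCube {η : ℝ} {cube : Set S} {ξ C : ℝ} (h : Reg335D2Cube T U η cube ξ C) : Reg335LipCube T U η cube ξ C C := by
  obtain ⟨u, A, hu, hg, hA, hD, hDD⟩ := h
  exact ⟨u, A, hu, hg, hA, hD, hDD⟩

/-- ★★ **THE THIRD GROUP LETTER IN THE CUBE GAUGE, TWO CONSTANTS** — for a gauge datum `(u, A)` with the clauses of `Reg335LipCube` as binders (`u`, `A` free), `η > 0`: at every `z` with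
`z, z+e_κ, z+e_κ′, z+e_κ+e_κ′ ∈ □`, `‖U^u_ν(z+e_κ+e_κ′) − U^u_ν(z+e_κ′) − U^u_ν(z+e_κ) + U^u_ν(z)‖ ≤ η³·((C₁∕ξ³) + η·(C∕ξ²)²)·e^{5ηC∕ξ}` (`U^u_ν = exp(iηA_ν)` at the four points;
`norm_exp_fourPoint_le` with `s = ηC∕ξ`, the exponents' second difference `iη·D¹D¹A_ν = iη·η²·∇∇A_ν` and first differences `iη·D¹A_ν = iη·η·∇A_ν`).
[cite: Balaban1985BackgroundPropagators, (3.35)–(3.36) p.396 (shape), Cor. 3.6 p.408 («U′ = U^u = e^{iηA}»)] -/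
theorem secondLetter_of_gauge335Lip {η : ℝ} (hη : 0 < η) {cube : Set S} {ξ C C₁ : ℝ} {u : S → 𝔸ˣ} {A : ι → S → 𝔸}
    (hg : ∀ κ, ∀ z ∈ cube, gaugeTr T u U κ z = fluct η A κ z) (hA : ∀ κ, ∀ z ∈ cube, ‖A κ z‖ < C * ξ⁻¹)
    (hD : ∀ κ ν, ∀ z ∈ cube, ‖((η : ℂ)⁻¹) • covD T (fun _ _ => (1 : 𝔸ˣ)) κ (A ν) z‖ < C * (ξ ^ 2)⁻¹)
    (hDD : ∀ κ κ' ν, ∀ z ∈ cube, ‖((η : ℂ)⁻¹) • covD T (fun _ _ => (1 : 𝔸ˣ)) κ' (fun w => ((η : ℂ)⁻¹) • covD T (fun _ _ => (1 : 𝔸ˣ)) κ (A ν) w) z‖ < C₁ * (ξ ^ 3)⁻¹)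
    (κ κ' ν : ι) (z : S) (hz : z ∈ cube) (hzκ : T κ z ∈ cube) (hzκ' : T κ' z ∈ cube) (hzκκ' : T κ (T κ' z) ∈ cube) :
    ‖(gaugeTr T u U ν (T κ (T κ' z)) : 𝔸) - gaugeTr T u U ν (T κ' z) - gaugeTr T u U ν (T κ z) + gaugeTr T u U ν z‖ ≤
      η ^ 3 * (((C₁ / ξ ^ 3) + η * (C / ξ ^ 2) ^ 2) * Real.exp (5 * (η * (C / ξ)))) := by
  -- sizes of the exponents
  have hX : ∀ w ∈ cube, ‖(Complex.I * η : ℂ) • A ν w‖ ≤ η * (C / ξ) := fun w hw => by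
    rw [norm_I_eta_smul hη.le]
    exact mul_le_mul_of_nonneg_left (by rw [div_eq_mul_inv]; exact (hA ν w hw).le) hη.le
  have hval : ∀ w ∈ cube, (gaugeTr T u U ν w : 𝔸) = exp ((Complex.I * η : ℂ) • A ν w) := fun w hw => by rw [hg ν w hw, val_fluct]
  -- first differences
  have hd1 : ∀ ρ, ‖(Complex.I * η : ℂ) • A ν (T ρ z) - (Complex.I * η : ℂ) • A ν z‖ ≤ η * (η * (C * (ξ ^ 2)⁻¹)) := fun ρ => by
    rw [← smul_sub, ← covD_one_apply' T, norm_I_eta_smul hη.le]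
    exact mul_le_mul_of_nonneg_left (norm_le_eta_mul_of_norm_inv_smul_lt hη (hD ρ ν z hz)) hη.le
  -- the second difference
  have hd2 : ‖(Complex.I * η : ℂ) • A ν (T κ (T κ' z)) - (Complex.I * η : ℂ) • A ν (T κ' z) - (Complex.I * η : ℂ) • A ν (T κ z) + (Complex.I * η : ℂ) • A ν z‖ ≤
      η * (η ^ 2 * (C₁ * (ξ ^ 3)⁻¹)) := by
    have e1 : (Complex.I * η : ℂ) • A ν (T κ (T κ' z)) - (Complex.I * η : ℂ) • A ν (T κ' z) - (Complex.I * η : ℂ) • A ν (T κ z) + (Complex.I * η : ℂ) • A ν z =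
        (Complex.I * η : ℂ) • covD T (fun _ _ => (1 : 𝔸ˣ)) κ' (fun w => covD T (fun _ _ => (1 : 𝔸ˣ)) κ (A ν) w) z := by
      rw [covD_one_covD_one_apply, smul_add, smul_sub, smul_sub]
    have e2 : covD T (fun _ _ => (1 : 𝔸ˣ)) κ' (fun w => ((η : ℂ)⁻¹) • covD T (fun _ _ => (1 : 𝔸ˣ)) κ (A ν) w) z =
        ((η : ℂ)⁻¹) • covD T (fun _ _ => (1 : 𝔸ˣ)) κ' (fun w => covD T (fun _ _ => (1 : 𝔸ˣ)) κ (A ν) w) z := by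
      rw [covD_one_apply', covD_one_apply' T κ' (fun w => covD T (fun _ _ => (1 : 𝔸ˣ)) κ (A ν) w), smul_sub]
    have h3 := hDD κ κ' ν z hz
    rw [e2] at h3
    have h5 := norm_le_eta_mul_of_norm_inv_smul_lt hη h3
    rw [norm_smul, norm_inv, Complex.norm_real, Real.norm_of_nonneg hη.le, inv_mul_le_iff₀ hη] at h5
    rw [e1, norm_I_eta_smul hη.le]
    calc η * ‖covD T (fun _ _ => (1 : 𝔸ˣ)) κ' (fun w => covD T (fun _ _ => (1 : 𝔸ˣ)) κ (A ν) w) z‖ ≤ η * (η * (η * (C₁ * (ξ ^ 3)⁻¹))) := by gcongr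
      _ = η * (η ^ 2 * (C₁ * (ξ ^ 3)⁻¹)) := by ring
  rw [hval _ hzκκ', hval _ hzκ', hval _ hzκ, hval _ hz]
  refine (norm_exp_fourPoint_le _ _ _ _ (hX z hz) (hX _ hzκ') (hX _ hzκ) (hX _ hzκκ')).trans ?_
  have hC3 : 0 ≤ η * (η ^ 2 * (C₁ * (ξ ^ 3)⁻¹)) := (norm_nonneg _).trans hd2
  calc (‖(Complex.I * η : ℂ) • A ν (T κ (T κ' z)) - (Complex.I * η : ℂ) • A ν (T κ' z) - (Complex.I * η : ℂ) • A ν (T κ z) + (Complex.I * η : ℂ) • A ν z‖ +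
          ‖(Complex.I * η : ℂ) • A ν (T κ' z) - (Complex.I * η : ℂ) • A ν z‖ * ‖(Complex.I * η : ℂ) • A ν (T κ z) - (Complex.I * η : ℂ) • A ν z‖) * Real.exp (5 * (η * (C / ξ)))
      ≤ (η * (η ^ 2 * (C₁ * (ξ ^ 3)⁻¹)) + (η * (η * (C * (ξ ^ 2)⁻¹))) * (η * (η * (C * (ξ ^ 2)⁻¹)))) * Real.exp (5 * (η * (C / ξ))) := by
        refine mul_le_mul_of_nonneg_right (add_le_add hd2 (mul_le_mul (hd1 κ') (hd1 κ) (norm_nonneg _) ((norm_nonneg _).trans (hd1 κ')))) (Real.exp_pos _).le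
    _ = η ^ 3 * (((C₁ / ξ ^ 3) + η * (C / ξ ^ 2) ^ 2) * Real.exp (5 * (η * (C / ξ)))) := by rw [div_eq_mul_inv, div_eq_mul_inv]; ring

/-- ★★ (∃-form) the datum on a cube ⟹ a gauge of unitary type on □ with ALL THREE letters of the transformed bond variables: `‖U^u_κ − 1‖ ≤ η(C∕ξ)e^{ηC∕ξ}` on □,
`‖U^u_ν(z+e_κ) − U^u_ν(z)‖ ≤ η²(C∕ξ²)e^{ηC∕ξ}` (`z, z+e_κ ∈ □`), `‖U^u_ν(z+e_κ+e_κ′) − U^u_ν(z+e_κ′) − U^u_ν(z+e_κ) + U^u_ν(z)‖ ≤ η³((C₁∕ξ³) + η(C∕ξ²)²)e^{5ηC∕ξ}` (the four points in □).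
[cite: Balaban1985BackgroundPropagators, (3.35)–(3.36) p.396 (shape), Cor. 3.6 p.408] -/
theorem exists_gauge_threeLetters_of_reg335LipCube {η : ℝ} (hη : 0 < η) {cube : Set S} {ξ C C₁ : ℝ} (h : Reg335LipCube T U η cube ξ C C₁) :
    ∃ u : S → 𝔸ˣ, (∀ z ∈ cube, ‖(u z : 𝔸)‖ ≤ 1 ∧ ‖(((u z)⁻¹ : 𝔸ˣ) : 𝔸)‖ ≤ 1) ∧
      (∀ κ, ∀ z ∈ cube, ‖(gaugeTr T u U κ z : 𝔸) - 1‖ ≤ η * (C / ξ) * Real.exp (η * (C / ξ))) ∧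
      (∀ κ ν, ∀ z ∈ cube, T κ z ∈ cube → ‖(gaugeTr T u U ν (T κ z) : 𝔸) - gaugeTr T u U ν z‖ ≤ η ^ 2 * (C / ξ ^ 2) * Real.exp (η * (C / ξ))) ∧
      (∀ κ κ' ν, ∀ z ∈ cube, T κ z ∈ cube → T κ' z ∈ cube → T κ (T κ' z) ∈ cube →
        ‖(gaugeTr T u U ν (T κ (T κ' z)) : 𝔸) - gaugeTr T u U ν (T κ' z) - gaugeTr T u U ν (T κ z) + gaugeTr T u U ν z‖ ≤
          η ^ 3 * (((C₁ / ξ ^ 3) + η * (C / ξ ^ 2) ^ 2) * Real.exp (5 * (η * (C / ξ))))) := by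
  obtain ⟨u, A, hu, hg, hA, hD, hDD⟩ := h
  obtain ⟨h1, h2⟩ := bondLetters_of_gauge335 T U hη hg hA hD
  exact ⟨u, hu, h1, h2, fun κ κ' ν z hz hzκ hzκ' hzκκ' => secondLetter_of_gauge335Lip T U hη hg hA hD hDD κ κ' ν z hz hzκ hzκ' hzκκ'⟩

end Generic

/-! ## §2 `𝔸 = M_n(ℂ)` (operator norm): a gauge unitary everywhere with the three letters, from the datum on a set -/

section MatrixOp

open scoped Matrix.Norms.L2Operator
open Literature.MathematicalPhysics.QuantumFieldTheory.Balaban1983to89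
open Literature.MathematicalPhysics.QuantumFieldTheory.Balaban1983to89.B9Eq39Adjoint (covD fluct)
open Literature.MathematicalPhysics.QuantumFieldTheory.Balaban1983to89.B9Eq3117Current (gaugeTr)

variable {n : Type} [Fintype n] [DecidableEq n] [Nonempty n] {X J : Type} (τ : J → X ≃ X) (U : J → X → (Matrix n n ℂ)ˣ)

/-- ★★★ **FROM THE DATUM ON A SET: A GAUGE UNITARY EVERYWHERE WITH THE POINTWISE LETTER, THE ALL-DIRECTION STEP LETTER AND THE THIRD (SECOND-DIFFERENCE) LETTER OF THE
TRANSFORMED BOND VARIABLES** — `Reg335LipCube τ U η Q ξ C C₁` (`η > 0`) ⟹ ∃ `w`, `w(y)ᴴw(y) = 1` for all `y` (the datum's gauge on `Q`, `1` off `Q`, as n15-c∕346), with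
`V_μ(z) = w(z)U_μ(z)w(z+e_μ)ᴴ`: (i) `‖V_μ(z) − 1‖ ≤ η(C∕ξ)e^{ηC∕ξ}` for `z, z+e_μ ∈ Q`; (ii) `‖V_μ(z+e_κ) − V_μ(z)‖ ≤ η²(C∕ξ²)e^{ηC∕ξ}` for `z, z+e_κ, z+e_μ, z+e_κ+e_μ ∈ Q`;
(iii) `‖V_μ(z+e_κ+e_κ′) − V_μ(z+e_κ′) − V_μ(z+e_κ) + V_μ(z)‖ ≤ η³((C₁∕ξ³) + η(C∕ξ²)²)e^{5ηC∕ξ}` whenever the four base points and their `μ`-neighbours lie in `Q`.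
[cite: Balaban1985BackgroundPropagators, (3.35)–(3.36) p.396 (shape), Cor. 3.6 p.408] -/
theorem uN_exists_gauge_threeLetters_of_reg335LipCube {η : ℝ} (hη : 0 < η) {Q : Set X} {ξ C C₁ : ℝ} (h : Reg335LipCube τ U η Q ξ C C₁) :
    ∃ w : X → Matrix n n ℂ, (∀ y, (w y)ᴴ * w y = 1) ∧
      (∀ μ z, z ∈ Q → τ μ z ∈ Q → ‖w z * (U μ z : Matrix n n ℂ) * (w (τ μ z))ᴴ - 1‖ ≤ η * ((C / ξ) * Real.exp (η * (C / ξ)))) ∧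
      (∀ κ μ z, z ∈ Q → τ κ z ∈ Q → τ μ z ∈ Q → τ μ (τ κ z) ∈ Q →
        ‖w (τ κ z) * (U μ (τ κ z) : Matrix n n ℂ) * (w (τ μ (τ κ z)))ᴴ - w z * (U μ z : Matrix n n ℂ) * (w (τ μ z))ᴴ‖ ≤ η ^ 2 * ((C / ξ ^ 2) * Real.exp (η * (C / ξ)))) ∧
      (∀ κ κ' μ z, z ∈ Q → τ κ z ∈ Q → τ κ' z ∈ Q → τ κ (τ κ' z) ∈ Q → τ μ z ∈ Q → τ μ (τ κ z) ∈ Q → τ μ (τ κ' z) ∈ Q → τ μ (τ κ (τ κ' z)) ∈ Q →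
        ‖w (τ κ (τ κ' z)) * (U μ (τ κ (τ κ' z)) : Matrix n n ℂ) * (w (τ μ (τ κ (τ κ' z))))ᴴ - w (τ κ' z) * (U μ (τ κ' z) : Matrix n n ℂ) * (w (τ μ (τ κ' z)))ᴴ -
            w (τ κ z) * (U μ (τ κ z) : Matrix n n ℂ) * (w (τ μ (τ κ z)))ᴴ + w z * (U μ z : Matrix n n ℂ) * (w (τ μ z))ᴴ‖ ≤
          η ^ 3 * (((C₁ / ξ ^ 3) + η * (C / ξ ^ 2) ^ 2) * Real.exp (5 * (η * (C / ξ))))) := by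
  classical
  obtain ⟨u, A, hu1, hg, hA, hD, hDD⟩ := h
  obtain ⟨huQ, h1, h2⟩ := uN_opLetters_of_gauge335 (T := τ) U (cube := Q) hη hu1 hg hA hD
  have h3 := secondLetter_of_gauge335Lip (T := τ) U hη hg hA hD hDD
  refine ⟨Q.piecewise (fun z => (u z : Matrix n n ℂ)) (fun _ => 1), fun y => ?_, fun μ z hz hz' => ?_, fun κ μ z hz hzκ hzμ hzκμ => ?_,
    fun κ κ' μ z hz hzκ hzκ' hzκκ' hzμ hzκμ hzκ'μ hzκκ'μ => ?_⟩
  · by_cases hy : y ∈ Q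
    · rw [Set.piecewise_eq_of_mem _ _ _ hy]; exact Matrix.mem_unitaryGroup_iff'.mp (huQ y hy)
    · rw [Set.piecewise_eq_of_notMem _ _ _ hy, Matrix.conjTranspose_one, Matrix.mul_one]
  · rw [Set.piecewise_eq_of_mem _ _ _ hz, Set.piecewise_eq_of_mem _ _ _ hz', ← uN_val_gaugeTr_eq (T := τ) U (huQ (τ μ z) hz')]
    exact (h1 μ z hz).trans (le_of_eq (mul_assoc _ _ _))
  · rw [Set.piecewise_eq_of_mem _ _ _ hz, Set.piecewise_eq_of_mem _ _ _ hzκ, Set.piecewise_eq_of_mem _ _ _ hzμ, Set.piecewise_eq_of_mem _ _ _ hzκμ,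
      ← uN_val_gaugeTr_eq (T := τ) U (huQ (τ μ z) hzμ), ← uN_val_gaugeTr_eq (T := τ) U (huQ (τ μ (τ κ z)) hzκμ)]
    exact (h2 κ μ z hz hzκ).trans (le_of_eq (mul_assoc _ _ _))
  · rw [Set.piecewise_eq_of_mem _ _ _ hz, Set.piecewise_eq_of_mem _ _ _ hzκ, Set.piecewise_eq_of_mem _ _ _ hzκ', Set.piecewise_eq_of_mem _ _ _ hzκκ',
      Set.piecewise_eq_of_mem _ _ _ hzμ, Set.piecewise_eq_of_mem _ _ _ hzκμ, Set.piecewise_eq_of_mem _ _ _ hzκ'μ, Set.piecewise_eq_of_mem _ _ _ hzκκ'μ,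
      ← uN_val_gaugeTr_eq (T := τ) U (huQ (τ μ z) hzμ), ← uN_val_gaugeTr_eq (T := τ) U (huQ (τ μ (τ κ z)) hzκμ),
      ← uN_val_gaugeTr_eq (T := τ) U (huQ (τ μ (τ κ' z)) hzκ'μ), ← uN_val_gaugeTr_eq (T := τ) U (huQ (τ μ (τ κ (τ κ' z))) hzκκ'μ)]
    exact h3 κ κ' μ z hz hzκ hzκ' hzκκ'

/-! ## §3 Non-vacuity -/

/-- NON-VACUITY: the trivial background `U ≡ 1` with the trivial gauge `u ≡ 1` and `A ≡ 0` is in `Reg335LipCube` on any set for all `ξ, C, C₁ > 0` and every `η`.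
[cite: Balaban1985BackgroundPropagators, (3.35)–(3.36) p.396 (shape)] -/
theorem reg335LipCube_one (η : ℝ) (Q : Set X) {ξ C C₁ : ℝ} (hξ : 0 < ξ) (hC : 0 < C) (hC₁ : 0 < C₁) :
    Reg335LipCube τ (fun (_ : J) (_ : X) => (1 : (Matrix n n ℂ)ˣ)) η Q ξ C C₁ := by
  refine ⟨fun _ => 1, fun _ _ => 0, fun z _ => ⟨?_, ?_⟩, fun κ z _ => ?_, fun κ z _ => ?_, fun κ ν z _ => ?_, fun κ κ' ν z _ => ?_⟩
  · rw [Units.val_one, norm_one]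
  · rw [inv_one, Units.val_one, norm_one]
  · rw [gaugeTr]
    apply Units.ext
    rw [val_fluct]
    simp
  · simp only [norm_zero]; positivity
  · simp only [covD_one_apply', sub_self, smul_zero, norm_zero]; positivity
  · simp only [covD_one_apply', sub_self, smul_zero, norm_zero]; positivity

end MatrixOp

/-! ## §4 (v1.1, appended) How Hölder-`β` data (`β < 1`, the series' proofs) enter: the Lipschitz clause with an `η`-dependent constant -/

section HolderStep

open Literature.MathematicalPhysics.QuantumFieldTheory.Balaban1983to89
open Literature.MathematicalPhysics.QuantumFieldTheory.Balaban1983to89.B9Eq39Adjoint (covD fluct)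
open Literature.MathematicalPhysics.QuantumFieldTheory.Balaban1983to89.B9Eq3117Current (gaugeTr)

variable {𝔸 : Type*} [NormedRing 𝔸] [NormedAlgebra ℂ 𝔸] [CompleteSpace 𝔸] {S ι : Type*} (T : ι → Equiv.Perm S) (U : ι → S → 𝔸ˣ)

/-- ★ **THE PER-STEP HÖLDER LETTER IS THE LIPSCHITZ CLAUSE WITH AN `η`-DEPENDENT CONSTANT**: if a gauge datum `(u, A)` satisfies the four clauses of (3.35) at `(ξ, C)` and the per-step
reading of the Hölder clause «‖A‖_{1,β} < C_β(Lʲη)^{−2−β}» — `‖∇^η_κA_ν(z+e_κ′) − ∇^η_κA_ν(z)‖ < C_β·ξ^{−(2+β)}·η^β` on □ (one lattice step has length `η`) —, then it is a `Reg335LipCube`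
witness at `(ξ, C, C₁)` with `C₁ := C_β·(ξ∕η)^{1−β}`, since `C₁ξ⁻³ = C_βξ^{−(2+β)}η^{β−1}` (`η, ξ > 0`).  So the chain's outputs (n15-c∕361–364), linear in `C₁`, hold for Hölder-`β` data with
`o_B = O(η·C₁) = O((ξ∕η)^{1−β}η) = O(η^β)` at fixed `ξ`. [cite: Balaban1985Variational, Thm 1 (9) p.279; Balaban1985RegularSpaces, Thm 2 (1.36) p.82 (β ≤ β₀ < 1); Balaban1985BackgroundPropagators, (3.40) p.397] -/
theorem reg335LipCube_of_holderStep {η : ℝ} (hη : 0 < η) {cube : Set S} {ξ C Cβ β : ℝ} (hξ : 0 < ξ) {u : S → 𝔸ˣ} {A : ι → S → 𝔸}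
    (hu : ∀ z ∈ cube, ‖(u z : 𝔸)‖ ≤ 1 ∧ ‖(((u z)⁻¹ : 𝔸ˣ) : 𝔸)‖ ≤ 1) (hg : ∀ κ, ∀ z ∈ cube, gaugeTr T u U κ z = fluct η A κ z)
    (hA : ∀ κ, ∀ z ∈ cube, ‖A κ z‖ < C * ξ⁻¹) (hD : ∀ κ ν, ∀ z ∈ cube, ‖((η : ℂ)⁻¹) • covD T (fun _ _ => (1 : 𝔸ˣ)) κ (A ν) z‖ < C * (ξ ^ 2)⁻¹)
    (hH : ∀ κ κ' ν, ∀ z ∈ cube, ‖((η : ℂ)⁻¹) • covD T (fun _ _ => (1 : 𝔸ˣ)) κ (A ν) (T κ' z) - ((η : ℂ)⁻¹) • covD T (fun _ _ => (1 : 𝔸ˣ)) κ (A ν) z‖ <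
      Cβ * ξ ^ (-(2 + β)) * η ^ β) :
    Reg335LipCube T U η cube ξ C (Cβ * (ξ / η) ^ (1 - β)) := by
  refine ⟨u, A, hu, hg, hA, hD, fun κ κ' ν z hz => ?_⟩
  have h := hH κ κ' ν z hz
  -- the constants: `η⁻¹·(C_β ξ^{−(2+β)} η^β) = C_β (ξ∕η)^{1−β} ξ⁻³`
  have hid : η⁻¹ * (Cβ * ξ ^ (-(2 + β)) * η ^ β) = Cβ * (ξ / η) ^ (1 - β) * (ξ ^ 3)⁻¹ := by
    rw [Real.div_rpow hξ.le hη.le, Real.rpow_sub hξ, Real.rpow_sub hη, Real.rpow_one, Real.rpow_one, Real.rpow_neg hξ.le, Real.rpow_add hξ,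
      show (ξ ^ 3 : ℝ) = ξ ^ (3 : ℝ) by norm_cast, show (ξ : ℝ) ^ (2 : ℝ) = ξ ^ (3 : ℝ) / ξ by rw [show (3 : ℝ) = 2 + 1 by norm_num, Real.rpow_add hξ, Real.rpow_one, mul_div_cancel_right₀ _ hξ.ne']]
    field_simp
  -- `η⁻¹ • D¹_{κ′}(η⁻¹ • D¹_κ A_ν)(z) = η⁻¹ • (∇_κA_ν(z+e_κ′) − ∇_κA_ν(z))`
  have e1 : covD T (fun _ _ => (1 : 𝔸ˣ)) κ' (fun w => ((η : ℂ)⁻¹) • covD T (fun _ _ => (1 : 𝔸ˣ)) κ (A ν) w) z =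
      ((η : ℂ)⁻¹) • covD T (fun _ _ => (1 : 𝔸ˣ)) κ (A ν) (T κ' z) - ((η : ℂ)⁻¹) • covD T (fun _ _ => (1 : 𝔸ˣ)) κ (A ν) z :=
    covD_one_apply' T κ' (fun w => ((η : ℂ)⁻¹) • covD T (fun _ _ => (1 : 𝔸ˣ)) κ (A ν) w) z
  rw [e1, norm_smul, norm_inv, Complex.norm_real, Real.norm_of_nonneg hη.le, ← hid]
  exact mul_lt_mul_of_pos_left h (inv_pos.mpr hη)

end HolderStep

end Summit.QuantumFields.YangMills.BalabanUVNodes.N15.CurvedSpecies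

end
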